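import Mathlib

/-!
# B3BlockTraceCap — the BLOCK-TRACE letter inequality in CLOSED FORM, the N36-apex CAP LAW on semihom-1's
# M5 «CAP» ray `a(4c+12)-dblC(c)`, and the twist-room census terms (hsemireg-monad-4 g18)

Companion to memo `B3-CAP-LAW-M5-monad4-g18.md` (crux workfile of `stmt-HodgeConjecture-18881`,
D-0145 token `line stmt-HodgeConjecture-18881 Cruxes/BlochSeedDiscOne/Lines/birth.lean 814a6a70c14e831a stub_rung_pad4_seedAt`).

PERIMETER / HONESTY.  Everything here is finite arithmetic on the LETTER-LEVEL surrogates of THEOREM BLOCK-TRACE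
(g14 v1.1) ∕ -TW (g15) ∕ -SH (g16) ∕ -MX (g17): the per-(class, factor) count `[(m − σ)(m − t) − 1]₊` and its
letter evaluation `σ = min m τ_f`, `t = min m τ`.  The geometric theorems themselves are PEN (memos g14–g17, ×2 of
record per director R19.511); nothing in this file is a statement about sheaves, monads, the design class, the crux
`BlochSeedDiscOne`, `stub_rung_pad4_seedAt`, HC, HC_CM, HC_AV, №4, 26512, 18881 or H2.  A «silent» row decides nothing;
a positive row is the letter-level certificate that the aligned-room display of that design is not semiregular.

Mathlib only · no `sorry` · no new axioms · no `instance` · no `notation` · no unsafe options.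

Contents
* §1 `betaF`, `cnt` (= g16 `betaF` ∕ g17 `cnt`, restated verbatim so that this file is self-contained), `cnt_eq`
  (the surrogates drop out: `cnt m τ τf = (m − τf)(m − τ) − 1`) and the CLOSED FORM: `betaF_eq_zero_iff`, `cnt_eq_zero_iff`, `cnt_eq_zero_iff_of_le`, `cnt_pos_iff_of_le`
  («COUNT-FAIL ⟺ τ ≤ m − 2 ∧ τ_f ≤ m − 1» when τ ≤ τ_f).
* §2 CAP LAW: `cap_law` (orphan-only block, `τ = 0`, `k ≥ 1` credited columns per factor: silent iff `m ≤ k`),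
  `cap_value`, and the rows of the M5 menu (`ray_plain`, `ray_sym`, `a32_row`, `a28_margin_zero`, `p83_rows`).
* §3 Twist-room terms (BLOCK-TRACE-TW shape, `t_j = 0`): `term`, `term_eq_zero_iff`, `term_eq_one_iff`,
  `two_le_term`, `betaTw`, `betaTw_eq_zero_iff`, and the room rows (`room_rows`, `aligned_consistency`).
* the Boolean table entry `btSilent` with `btSilent_iff` (`= true ↔ blockCnt = 0` in the regime `τ ≤ τ_f`).
-/

namespace Summit.HodgeConjecture.HodgeConjecture.Cruxes.BlochSeedDiscOne.BlockTraceCap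

/-! ## §1 The count and its closed form -/

/-- per-(class η, factor) count of THEOREM BLOCK-TRACE(-SH∕-MX): `[(m − σ)(m − t) − 1]₊` (ℕ-subtraction is the
positive part).  Verbatim g16 `BlockTraceSH.betaF`. -/
def betaF (m t σ : ℕ) : ℕ := (m - σ) * (m - t) - 1

/-- letter-level evaluation with the surrogates `t = min m τ` (fed ∕ visible column mass) and `σ = min m τf`
(`τf = τ +` credited orphan column mass on the factor).  Equals g17 `BlockTraceMX.cnt m τ τf`. -/
def cnt (m τ τf : ℕ) : ℕ := betaF m (min m τ) (min m τf)

/-- `m − min m τ = m − τ` in ℕ. -/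
theorem sub_min_self (m τ : ℕ) : m - min m τ = m - τ := by omega

/-- the surrogates drop out of the formula: `cnt m τ τf = (m − τf)(m − τ) − 1` (truncated subtraction). -/
theorem cnt_eq (m τ τf : ℕ) : cnt m τ τf = (m - τf) * (m - τ) - 1 := by
  unfold cnt betaF; rw [sub_min_self m τf, sub_min_self m τ]

/-- an ℕ-product is `≤ 1` iff a factor vanishes or both are `1`. -/
theorem mul_le_one_iff (a b : ℕ) : a * b ≤ 1 ↔ a = 0 ∨ b = 0 ∨ (a = 1 ∧ b = 1) := by
  constructor
  · intro h
    rcases Nat.eq_zero_or_pos a with ha | ha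
    · exact Or.inl ha
    rcases Nat.eq_zero_or_pos b with hb | hb
    · exact Or.inr (Or.inl hb)
    right; right
    have h1 : a * b = 1 := by
      have : 1 ≤ a * b := Nat.one_le_iff_ne_zero.mpr (Nat.mul_ne_zero_iff.mpr ⟨by omega, by omega⟩)
      omega
    exact mul_eq_one.mp h1
  · rintro (h | h | ⟨h1, h2⟩)
    · simp [h]
    · simp [h]
    · simp [h1, h2]

/-- CLOSED FORM of the per-factor count: zero iff `σ ≥ m` or `t ≥ m` or `σ = t = m − 1`. -/
theorem betaF_eq_zero_iff (m t σ : ℕ) :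
    betaF m t σ = 0 ↔ (m ≤ σ ∨ m ≤ t ∨ (m = σ + 1 ∧ m = t + 1)) := by
  unfold betaF
  rw [Nat.sub_eq_zero_iff_le, mul_le_one_iff]
  omega

/-- CLOSED FORM at letter level (no hypothesis): `cnt m τ τf = 0 ↔ τf ≥ m ∨ τ ≥ m ∨ (τ = m − 1 ∧ τf = m − 1)`
(for `m ≥ 1`; for `m = 0` both sides hold). -/
theorem cnt_eq_zero_iff (m τ τf : ℕ) :
    cnt m τ τf = 0 ↔ (m ≤ τf ∨ m ≤ τ ∨ (m = τ + 1 ∧ m = τf + 1)) := by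
  rw [cnt_eq, Nat.sub_eq_zero_iff_le, mul_le_one_iff]
  omega

/-- THE LETTER INEQUALITY (B3-BT) in the regime of every block of record (`τ ≤ τf`, automatic since `τf = τ + credited
orphan mass`): the block is BT-silent iff `τf ≥ m` or `τ ≥ m − 1`. -/
theorem cnt_eq_zero_iff_of_le {m τ τf : ℕ} (h : τ ≤ τf) :
    cnt m τ τf = 0 ↔ (m ≤ τf ∨ m ≤ τ + 1) := by
  rw [cnt_eq_zero_iff]; omega

/-- … equivalently COUNT-FAIL iff `τ ≤ m − 2` and `τf ≤ m − 1`. -/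
theorem cnt_pos_iff_of_le {m τ τf : ℕ} (h : τ ≤ τf) :
    0 < cnt m τ τf ↔ (τ + 2 ≤ m ∧ τf + 1 ≤ m) := by
  rw [Nat.pos_iff_ne_zero, Ne, cnt_eq_zero_iff_of_le h]; omega

/-- sanity: the closed form reproduces g17's two special cases `cnt3_pos_iff` ∕ `cnt2_pos_iff`. -/
theorem cnt3_pos_iff' (τη : ℕ) : 0 < cnt 3 0 τη ↔ τη ≤ 2 := by
  rw [cnt_pos_iff_of_le (Nat.zero_le _)]; omega

theorem cnt2_pos_iff' (τη : ℕ) : 0 < cnt 2 0 τη ↔ τη ≤ 1 := by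
  rw [cnt_pos_iff_of_le (Nat.zero_le _)]; omega

/-! ## §2 The CAP LAW and the M5-menu rows -/

/-- CAP LAW.  An orphan-only block (`τ = 0`: no fed, no visible feeder) with `k ≥ 1` credited orphan columns on the
factor is BT-silent on that factor iff its multiplicity is at most `k`.  (N36 apex classes of the CAP ray: `k = 4`
plain ∕ flipped, `k = 8` τ-symmetrised.) -/
theorem cap_law {m k : ℕ} (hk : 1 ≤ k) : cnt m 0 k = 0 ↔ m ≤ k := by
  rw [cnt_eq_zero_iff_of_le (Nat.zero_le _)]; omega

/-- … and past the cap the per-factor count is `(m − k)·m − 1 ≥ m − 1`. -/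
theorem cap_value {m k : ℕ} (_h : k < m) : cnt m 0 k = (m - k) * m - 1 := by
  rw [cnt_eq, Nat.sub_zero]

theorem cap_value_ge {m k : ℕ} (h : k < m) : m - 1 ≤ cnt m 0 k := by
  rw [cap_value h]
  have : m ≤ (m - k) * m := Nat.le_mul_of_pos_left m (by omega)
  omega

/-- THE PLAIN CAP RAY `a(4c+12)-dblC(c)` (semihom-1 g31lib: `apex_menu(D5A16, ALL16 + (c−2)·DBLN4, ADDR4·(c+2))`):
the four two-bit apex classes N36∈{0011,0110,1100,1001} have multiplicity `m = c`, `τ = 0`, `τ_f = 4` on every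
factor (32 orphan A-feeders: 16 P70 RAY⁴ + 16 P72 EQ on exactly one factor, 4 per factor).  Per-factor counts for
`c = 2 … 7`: silent, silent (M1, margin 1), silent (a28-dblC4, margin 0), then 4, 11, 20. -/
theorem ray_plain : cnt 2 0 4 = 0 ∧ cnt 3 0 4 = 0 ∧ cnt 4 0 4 = 0 ∧ cnt 5 0 4 = 4 ∧ cnt 6 0 4 = 11 ∧ cnt 7 0 4 = 20 := by
  decide

/-- `a32-dblC5` (c = 5): `β_pure = 4 factors × 4 = 16` per apex block, four apex blocks ⇒ `64` (instrument digit
`COUNT-FAIL [pure 16 + mixed 0] × 4`). -/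
theorem a32_row : 4 * cnt 5 0 4 = 16 ∧ 4 * (4 * cnt 5 0 4) = 64 := by decide

/-- `a28-dblC4` (c = 4) sits AT the cap: silent with all four credited columns independent (`σ_f = 4`), dead by `3`
per deficient factor as soon as one credited column is lost or dependent (`σ_f = 3`); M1 (c = 3) has margin one. -/
theorem a28_margin_zero : cnt 4 0 4 = 0 ∧ cnt 4 0 3 = 3 ∧ betaF 4 0 3 = 3 ∧ cnt 3 0 3 = 0 ∧ cnt 3 0 2 = 2 := by decide

/-- THE τ-SYM RAY (`-sym`: mirrored P72 cells double the EQ feeders, `τ_f = 8`): cap `c ≤ 8`. -/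
theorem ray_sym : cnt 3 0 8 = 0 ∧ cnt 4 0 8 = 0 ∧ cnt 5 0 8 = 0 ∧ cnt 8 0 8 = 0 ∧ cnt 9 0 8 = 8 := by decide

/-- the one-bit ∕ three-bit N36 classes (`m = 2` on the whole ray) and the MX surrogate of the apex classes
(best `τ_η = 18` plain, `28` sym, g17) are silent throughout. -/
theorem n36_other_rows : cnt 2 0 4 = 0 ∧ cnt 5 0 18 = 0 ∧ cnt 8 0 18 = 0 ∧ cnt 5 0 28 = 0 := by decide

/-- P83 hub blocks (TOP C, `m = c + 3`, fed∕visible mass `τ ∈ {18, 26, 42}` plain ∕ flipped, `{34, 42, 58}` sym,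
`τ_f = τ`): silent iff `m ≤ τ + 1`, i.e. up to `c = 16` on the plain ray — never binding before the apex cap. -/
theorem p83_rows : cnt 6 18 18 = 0 ∧ cnt 7 18 18 = 0 ∧ cnt 8 18 18 = 0 ∧ cnt 19 18 18 = 0 ∧ cnt 20 18 18 = 3 ∧
    cnt 7 26 26 = 0 ∧ cnt 8 42 42 = 0 ∧ cnt 7 34 34 = 0 := by decide

/-- P74 top blocks of the sym designs (`m = 2`, `τ ∈ {4, 5}`): silent. -/
theorem p74_rows : cnt 2 4 4 = 0 ∧ cnt 2 5 5 = 0 := by decide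

/-- BT-silence test of a block at letter level over its four factors (the checkable (B3-BT) table entry), as a
Boolean: `m ≤ τ + 1 ∨ ∀ f, m ≤ τ_f`. -/
def btSilent (m τ : ℕ) (τf : Fin 4 → ℕ) : Bool := decide (m ≤ τ + 1 ∨ ∀ f, m ≤ τf f)

/-- the letter-level block count `β(Z) = Σ_f cnt m τ (τf f)`. -/
def blockCnt (m τ : ℕ) (τf : Fin 4 → ℕ) : ℕ := ∑ f, cnt m τ (τf f)

/-- THE (B3-BT) TABLE ENTRY: in the regime `τ ≤ τ_f` a block is silent iff `m ≤ τ + 1` or `m ≤ τ_f` on every factor. -/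
theorem blockCnt_eq_zero_iff {m τ : ℕ} {τf : Fin 4 → ℕ} (h : ∀ f, τ ≤ τf f) :
    blockCnt m τ τf = 0 ↔ (m ≤ τ + 1 ∨ ∀ f, m ≤ τf f) := by
  unfold blockCnt
  rw [Finset.sum_eq_zero_iff]
  simp only [Finset.mem_univ, true_implies]
  constructor
  · intro H
    by_cases hm : m ≤ τ + 1
    · exact Or.inl hm
    · right; intro f
      have := (cnt_eq_zero_iff_of_le (h f)).mp (H f)
      omega
  · rintro (H | H) f
    · exact (cnt_eq_zero_iff_of_le (h f)).mpr (Or.inr H)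
    · exact (cnt_eq_zero_iff_of_le (h f)).mpr (Or.inl (H f))

theorem btSilent_iff {m τ : ℕ} {τf : Fin 4 → ℕ} (h : ∀ f, τ ≤ τf f) :
    btSilent m τ τf = true ↔ blockCnt m τ τf = 0 := by
  rw [blockCnt_eq_zero_iff h]; simp [btSilent]

/-- the M5 rows through the Boolean test: apex a28 ∕ a32 ∕ a32-sym, hub P83 of a32, P74 of the sym designs. -/
theorem btSilent_rows : btSilent 4 0 (fun _ => 4) = true ∧ btSilent 5 0 (fun _ => 4) = false ∧
    btSilent 5 0 (fun _ => 8) = true ∧ btSilent 8 18 (fun _ => 18) = true ∧ btSilent 2 4 (fun _ => 4) = true := by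
  decide

/-- the apex rows as block counts: a28 silent (`0`), a32 `16`. -/
theorem apex_blockCnt : blockCnt 4 0 (fun _ => 4) = 0 ∧ blockCnt 5 0 (fun _ => 4) = 16 ∧ blockCnt 5 0 (fun _ => 8) = 0 := by
  decide

/-! ## §3 Twist-room terms (BLOCK-TRACE-TW shape; orphan-only blocks, `t_j = 0` in every room by TWIST-MONOTONE-SH)

A room splits the `c` copies of an apex class into twist classes `j` of multiplicity `m_j` (`Σ m_j = c`); class `j`
keeps `e_{f,j}` EQ_f-feeders alive (`4` if untwisted; `0` on every factor where its twist is non-trivial; on the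
other factors the survivors of the ray-compatibility rule).  Per factor the TW count is `[Σ_j (m_j − σ_{f,j})·m_j − 1]₊`
with `σ_{f,j} ≤ min m_j e_{f,j}` (equality for independent columns). -/

/-- one twist class's per-factor term `(m − min m e)·m`. -/
def term (m e : ℕ) : ℕ := (m - min m e) * m

/-- `term m e = (m − e)·m`. -/
theorem term_eq (m e : ℕ) : term m e = (m - e) * m := by
  unfold term; rw [sub_min_self]

/-- per-factor TW count of a room, classes given as `(m_j, e_{f,j})`. -/
def betaTw (cs : List (ℕ × ℕ)) : ℕ := (cs.map fun c => term c.1 c.2).sum - 1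

theorem betaTw_eq_zero_iff (cs : List (ℕ × ℕ)) : betaTw cs = 0 ↔ (cs.map fun c => term c.1 c.2).sum ≤ 1 := by
  unfold betaTw; omega

/-- a class contributes nothing iff it keeps at least `m` credited columns (or is empty). -/
theorem term_eq_zero_iff (m e : ℕ) : term m e = 0 ↔ (m ≤ e ∨ m = 0) := by
  rw [term_eq, Nat.mul_eq_zero]; omega

/-- a class contributes exactly `1` iff it is a BARE SINGLETON on that factor (`m = 1`, no credited column). -/
theorem term_eq_one_iff (m e : ℕ) : term m e = 1 ↔ (m = 1 ∧ e = 0) := by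
  rw [term_eq, mul_eq_one]; omega

/-- otherwise (deficient class of multiplicity ≥ 2) it contributes at least `2` — alone enough to kill the factor. -/
theorem two_le_term {m e : ℕ} (hm : 2 ≤ m) (he : e < m) : 2 ≤ term m e := by
  rw [term_eq]
  have : m ≤ (m - e) * m := Nat.le_mul_of_pos_left m (by omega)
  omega

/-- ROOM ROWS for one apex class of the plain ray on a factor `h`:
`c = 5` aligned: dead (`4`); `4 ⊕ 1` with the singleton twisted non-trivially on `h` (bare there): silent;
`4 ⊕ 1 ⊕ 1` both bare on `h`: dead (`1`); `4 ⊕ 2` with the pair twisted on `h`: dead (`3`); `3 ⊕ 1 ⊕ 1`: dead (`1`);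
M1's generic room `1 ⊕ 1 ⊕ 1` (g16 `n36_genericRoom`): dead (`2`); `4 ⊕` one singleton bare on `h` and three
singletons each keeping one EQ_h feeder (twists on the other three factors): silent — the `c = 8` room. -/
theorem room_rows :
    betaTw [(5, 4)] = 4 ∧ betaTw [(4, 4), (1, 0)] = 0 ∧ betaTw [(4, 4), (1, 0), (1, 0)] = 1 ∧
    betaTw [(4, 4), (2, 0)] = 3 ∧ betaTw [(3, 4), (1, 0), (1, 0)] = 1 ∧ betaTw [(1, 0), (1, 0), (1, 0)] = 2 ∧
    betaTw [(4, 4), (1, 0), (1, 1), (1, 1), (1, 1)] = 0 ∧ betaTw [(4, 4), (1, 1), (1, 1), (1, 1), (1, 1)] = 0 := by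
  decide

/-- consistency with §2: the unsplit class reproduces the aligned count (`term c 4 − 1 = cnt c 0 4`). -/
theorem aligned_consistency : ∀ c ∈ [2, 3, 4, 5, 6, 7, 8], betaTw [(c, 4)] = cnt c 0 4 := by decide

end Summit.HodgeConjecture.HodgeConjecture.Cruxes.BlochSeedDiscOne.BlockTraceCap
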